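import Summits.ABC.ABC.Theses.PlacewiseSzpiro
import Summits.ABC.ABC.Theorems.PlacewiseSzpiroPayoff
import Summits.ABC.ABC.Theorems.PlacewiseSzpiroSingleTowerCalib
import Summits.ABC.ABC.Theorems.PlacewiseSzpiroSingleTowerSzpiroStubPotentiallyGoodTowerOdd
import Summits.ABC.ABC.Theorems.PlacewiseSzpiroSingleTowerSzpiroStubPotentiallyGoodOrdTwo
import Summits.ABC.ABC.Theorems.PlacewiseSzpiroSingleTowerSzpiroStubTwistTransferOdd
import Summits.ABC.ABC.Theorems.PlacewiseSzpiroSingleTowerSzpiroStubTwistTransferTwo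
import Summits.ABC.ABC.Theorems.PlacewiseSzpiroSingleTowerSzpiroIffMultiplicative
import Summits.ABC.ABC.Theorems.PlacewiseSzpiroSingleTowerSzpiroFirstDeliverableCalib
import Summits.ABC.ABC.Theorems.PlacewiseSzpiroSingleTowerSzpiroFreyLargePrimes
import Summits.ABC.ABC.Theorems.PlacewiseSzpiroSingleTowerSzpiroMersenneRadicalRungs
import HarnessLib

/-!
# Crux `SingleTowerSzpiro` (stmt-ABC-22410) — line `birth`: registered skeleton (published copy)

Crux X1 of route PlacewiseSzpiro:
`Summit.ABC.ABC.Theses.PlacewiseSzpiro.SingleTowerSzpiro := ∀ ε > 0, ∃ C, ∀ E/ℚ, ∀ v,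
ord_v(Δ_min(E)) · log p_v ≤ (6 + ε) · log N_E + C`.

REV 6 (lead abc-harv-pr-3; authored by g2 2026-08-28T00:06Z = item evidence #14 on stmt-ABC-22410,
sha256 8bed15f846a7db28…, the REGISTERED skeleton; this tree copy re-authored from the record by g3, because
`run/gate/evidence/` is not mounted in seat jails — same registered stub set, same composition, prose mine).
**Registered stubs = {`stub_multiplicativeTower`} = THE CRUX.** `stub_firstDeliverable_towerBelowStewartYu`
(critic's first deliverable `∃ δ > 0: tower ≤ C · N_E^{1/3−δ}`, orphan in the composition since rev 1) is
RETIRED as MISSTATED per the route planner's RULING (abc-idea-2, 2026-08-27T23:30:00Z), on the kernel evidence of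
★ p584725 `Theorems/PlacewiseSzpiroSingleTowerSzpiroFirstDeliverableCalib.lean`:
`firstDeliverable_iff_exists_szpiroEpsShape_lt_third` — FD ⟺ `∃ α < 1/3, Summit.ABC.Harvest.SzpiroEpsShape α`,
i.e. over all `E/ℚ` at polynomial scale `N^{1/3−δ}` place-locality is vacuous and FD = «beat Murty–Pasten's
α = 1 for all E AND Stewart–Yu 2001 on the Frey locus» (`Literature.Barriers.ABC.BakerMethodBounds`); no repaired
polynomial-scale stub is registered (small places are Baker-cheap ★ p585329/p585848, the large-place complement
≡ `EpsShapeBound θ < 1/3` ★ p586559, the fixed-place polylog scale ≡ Mersenne-radical growth ★ p587522/p587903 —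
planner's census line: «below S1 there is no deliverable that is neither Baker-cheap nor a named open problem»).
REV 5/5b (g2, 2026-08-27T23:50Z / 08-28T00:04Z; evidence #11/#12): stubs unchanged, the calibration theorems
imported and cited BY NAME (§ Calibration below). The LINE IS COMPLETE AS A TYPED LINE (planner (4), desk WIDTH 0):
X1 ⟺ S1 (★ p581193), payoff ★ p575330, and no provable-now stub is left; S1 stays uninvited per PRICE.

HISTORY. REV 4 (lead abc-harv-pr-3, 2026-08-27 — RESHAPED rev 2/3; ALL BOOKKEEPING STUBS LANDED rev 4). Rev 1 was the published copy of the planner's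
(abc-idea-2) registered BC3 skeleton (stubs `stub_multiplicativeTower` / `stub_nonMultiplicativeTower` /
`stub_firstDeliverable_towerBelowStewartYu`, composition by the case split `f_v = 1`). The lead found
`stub_nonMultiplicativeTower` CRUX-COMPLETE (twist transfer, `Lines/birth.md` §Assessment) and reshapes the
complement of the crux into honest, provable bookkeeping: the split is now by (reduction type, sign of
`v(j_E)`). Registered stubs of rev 2 (sorries = the open ones):
* `stub_multiplicativeTower` (UNCHANGED, the crux proper; OPEN);
* `stub_potentiallyGoodTowerOdd` (NEW; **PROVED** by the lead, file
  `Theorems/PlacewiseSzpiroSingleTowerSzpiroStubPotentiallyGoodTowerOdd.lean`): `v ∤ 2`, `v(j_E) ≥ 0` ⇒ tower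
  `≤ 5 log N_E + C` (Tate's algorithm: `m_v ≤ 9`, Ogg, `f_v = 2` for `p ≥ 5`, `f_3 ≤ 5`);
* `stub_potentiallyGoodOrdTwo` (NEW; **LANDED p578899 by abc-harv-pr-4**, B = 18 via Tate's algorithm at 2; the text below was the lead's plan): `v ∣ 2`, `v(j_E) ≥ 0` ⇒ `ord_2(Δ_min) ≤ B`
  (`B = 21` from Kraus 1989 Prop. 2 at `2`: a `2`-minimal model has `v(c₄) ≤ 7` or `v(c₆) ≤ 10`, and
  `v(Δ) = 3v(c₄) − v(j) = 2v(c₆) − v(j − 1728)`; needs the SUFFICIENCY half of Kraus at `2`, the tree has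
  necessity only, `LocalReductionKrausTwo`);
* `stub_twistTransferOdd` (**LANDED p580133 by the lead**) / `stub_twistTransferTwo` (**LANDED p580442 by abc-harv-pr-4**) (bookkeeping): the multiplicative-tower statement implies the bound
  at the additive potentially-multiplicative places (`f_v ≠ 1`, `v(j_E) < 0`): quadratic twist by the
  character ramified exactly at `p` (`p*` for odd `p`; conductor `4`/`8` at `p = 2`), `N_E = p^{f_v−1}·N_{E⊗χ}`,
  `ord_v Δ_min(E) = ord_v Δ_min(E⊗χ) + 6(f_v − 1)` — tree API `QuadraticTwist*`, `QuadraticTwistTateForm(Two)Proofs`;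
* `stub_firstDeliverable_towerBelowStewartYu` (rev 1–5: the critic's first deliverable, orphan in the composition;
  **RETIRED rev 6 as MISSTATED**, see REV 6 above).
`stub_nonMultiplicativeTower` of rev 1 is WITHDRAWN (= `stub_potentiallyGood*` ∧ `stub_twistTransfer`(S1), i.e.
crux-complete on its own). Composition `SingleTowerSzpiro_of`: `f_v = 1` → S1; else `v(j) ≥ 0` → potentially
good (odd / two); else → twist transfer of S1. Sorries (rev 4): exactly `stub_multiplicativeTower` (THE CRUX) and
`stub_firstDeliverable_towerBelowStewartYu` (critic's target, not used by the composition); the four bookkeeping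
stubs are imported PROVED — so `SingleTowerSzpiro_of_stubs` now certifies **X1 ⟸ stub_multiplicativeTower alone**.

STUB ASSESSMENT (lead, 2026-08-27 — see `Lines/birth.md` §Assessment for the argument):
* `stub_multiplicativeTower` (f_v = 1): the crux proper (one Tate parameter against the global conductor).
  OPEN; nothing in print gives it (PRICE: «no inequality-producing instance of the place-local currency»).
* `stub_nonMultiplicativeTower` (f_v ≠ 1): NOT an easy complement — at an additive place of POTENTIALLY
  MULTIPLICATIVE reduction the tower is `(n' + 6) · log p` (`p` odd) with `n'` the multiplicative tower of
  the quadratic twist by `p* = ±p ≡ 1 (4)`, whose conductor is `N_E / p`; hence this stub IMPLIES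
  `stub_multiplicativeTower` (with `2ε`) and is crux-complete. The honest easy complement is the
  potentially-GOOD part (`v(j_E) ≥ 0`): `ord_v(Δ_min) ≤ 10` for `p ≥ 5` (Tate's algorithm, tree
  `ordMinimalDiscriminant_eq_numComponentsAt_add_one_holds`), bounded at `2, 3` (Kraus 1990 /
  Papadopoulos 1993), so those towers are `≤ 5 · log N_E + O(1)` — inside the budget with room.
  Proposed reshape (not yet registered): `stub_potentiallyGoodTower` + `stub_jPoleTower`
  (`max(0, −v_p(j_E)) · log p ≤ (6+ε) log N_E + C`, the crux in Tate-parameter form) +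
  `stub_towerLeOfJPole` (`ord_v(Δ_min) ≤ K + max(0, −v_p(j_E))`, classical).
* `stub_firstDeliverable_towerBelowStewartYu` (critic's first deliverable, `∃ δ > 0`: tower `≤ C · N^{1/3−δ}`):
  OPEN — would be a new theorem (Stewart–Yu 2001 give `log|Δ_min| ≪ N^{1/3}(log N)³` for the SUM; no
  per-place improvement is in print; Ribet–Takahashi `n_p · n_q ∣ deg φ`-type relations bound `n_p` by the
  modular degree, polynomial in `N` at best, far above `log N`-scale).

POSITION OF X1 (kernel-checked, `Theorems/PlacewiseSzpiroSingleTowerCalib.lean`, `…Payoff.lean`):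
`ABC ⟹ SzpiroConjecture(6+ε) ⟹ SingleTowerSzpiro ⟹ Summit.ABC.Harvest.SubexponentialSzpiro`.
No summit and no rung is proved by this file; typed ≠ proved; A1′ / A-PS are NOT abc.
-/

noncomputable section

-- `Summit.<Summit>.<Problem>` is the mandated summit-side namespace (CONVENTIONS §2); for the
-- single-conjunct summit `ABC` the two coincide, so the duplicate `ABC.ABC` is deliberate.
set_option linter.dupNamespace false

namespace Summit.ABC.ABC.Cruxes.SingleTowerSzpiro.Birth

open IsDedekindDomain
open Summit.ABC.ABC.Theses.PlacewiseSzpiro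

/-- REGISTERED STUB (T1, load-bearing — the crux proper): at places of multiplicative reduction
(`f_v = 1`) the tower `ord_v(Δ_min) · log p_v = −v(j_E) · log p_v` obeys the generalized-Szpiro budget.
OPEN. -/
theorem stub_multiplicativeTower : ∀ ε : ℝ, 0 < ε → ∃ C : ℝ, ∀ (W : WeierstrassCurve ℚ) [W.IsElliptic] (v : HeightOneSpectrum ℤ), W.conductorExponent v = 1 → (W.ordMinimalDiscriminant v : ℝ) * Real.log (Rat.HeightOneSpectrum.natGenerator v : ℝ) ≤ (6 + ε) * Real.log (W.conductorNorm ℤ : ℝ) + C := by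
  sorry

/-- REGISTERED STUB (S2-odd; PROVED — `Summit.ABC.ABC.Theorems.SingleTowerSzpiroLine.stub_potentiallyGoodTowerOdd`):
at a place `v ∤ 2` where `j_E` is `v`-integral (potentially good reduction) the tower is `≤ 5 log N_E + C`
(Tate's algorithm; Silverman ATAEC IV.9.4, Table 4.1, IV.10.4). -/
theorem stub_potentiallyGoodTowerOdd : ∃ C : ℝ, ∀ (W : WeierstrassCurve ℚ) [W.IsElliptic] (v : HeightOneSpectrum ℤ), Rat.HeightOneSpectrum.natGenerator v ≠ 2 → v.valuation ℚ W.j ≤ 1 → (W.ordMinimalDiscriminant v : ℝ) * Real.log (Rat.HeightOneSpectrum.natGenerator v : ℝ) ≤ 5 * Real.log (W.conductorNorm ℤ : ℝ) + C :=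
  Summit.ABC.ABC.Theorems.SingleTowerSzpiroLine.stub_potentiallyGoodTowerOdd

/-- REGISTERED STUB (S2-two; classical, OPEN in the tree): at the place over `2`, potentially good reduction
(`v(j_E) ≥ 0`) forces `ord_2(Δ_min(E)) ≤ B` for an absolute `B` (`B = 21` suffices: Kraus 1989 Prop. 2 —
an integral model with invariants `(c₄/16, c₆/64)` exists as soon as `2⁸ ∣ c₄` and `2¹¹ ∣ c₆`, so a `2`-minimal
model has `v(c₄) ≤ 7` or `v(c₆) ≤ 10`, whence `v(Δ) = 3v(c₄) − v(j) ≤ 21` or `v(Δ) = 2v(c₆) − v(j − 1728) ≤ 20`;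
Papadopoulos 1993 Table IV lists the actual values). Needs the sufficiency half of Kraus at `2`
(the tree's `LocalReductionKrausTwo` proves necessity only). -/
theorem stub_potentiallyGoodOrdTwo : ∃ B : ℕ, ∀ (W : WeierstrassCurve ℚ) [W.IsElliptic] (v : HeightOneSpectrum ℤ), Rat.HeightOneSpectrum.natGenerator v = 2 → v.valuation ℚ W.j ≤ 1 → W.ordMinimalDiscriminant v ≤ B :=
  Summit.ABC.ABC.Theorems.SingleTowerSzpiroLine.stub_potentiallyGoodOrdTwo

/-- REGISTERED STUB (S3-odd, twist transfer at the odd places; bookkeeping, OPEN in the tree): the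
multiplicative-tower bound implies the bound at the additive places `v ∤ 2` of potentially multiplicative
reduction (`f_v ≠ 1`, `v(j_E) < 0`). Such an `E` is the quadratic twist of a curve `E'` with multiplicative
reduction at `p = p_v` by `ℚ(√p*)`, `p* ≡ 1 mod 4` (ramified exactly at `p`), with the same local data at every
other place; so `p · N_{E'} ∣ N_E` (`f_v(E) ≥ 2`, `f_v(E') = 1`) and `ord_v Δ_min(E) ≤ ord_v Δ_min(E') + 6`
(the twist of a `v`-minimal model of `E'` is a `v`-integral model of `E` with `Δ ↦ p*⁶ Δ`), whence
`tower(E) ≤ tower(E') + 6 log p ≤ (6+ε)(log N_E − log p) + C + 6 log p ≤ (6+ε) log N_E + C`. Silverman ATAEC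
IV.9.4 Step 7 / Ex. 4.37; tree API `Literature.NumberTheory.EllipticCurves.QuadraticTwist*`,
`exists_hasMultiplicativeReductionAt_quadraticTwist_of_one_lt_valuation_j`, `conductorExponent_twistModel`. -/
theorem stub_twistTransferOdd : (∀ ε : ℝ, 0 < ε → ∃ C : ℝ, ∀ (W : WeierstrassCurve ℚ) [W.IsElliptic] (v : HeightOneSpectrum ℤ), W.conductorExponent v = 1 → (W.ordMinimalDiscriminant v : ℝ) * Real.log (Rat.HeightOneSpectrum.natGenerator v : ℝ) ≤ (6 + ε) * Real.log (W.conductorNorm ℤ : ℝ) + C) → ∀ ε : ℝ, 0 < ε → ∃ C : ℝ, ∀ (W : WeierstrassCurve ℚ) [W.IsElliptic] (v : HeightOneSpectrum ℤ), Rat.HeightOneSpectrum.natGenerator v ≠ 2 → W.conductorExponent v ≠ 1 → 1 < v.valuation ℚ W.j → (W.ordMinimalDiscriminant v : ℝ) * Real.log (Rat.HeightOneSpectrum.natGenerator v : ℝ) ≤ (6 + ε) * Real.log (W.conductorNorm ℤ : ℝ) + C :=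
  Summit.ABC.ABC.Theorems.SingleTowerSzpiroLine.stub_twistTransferOdd

/-- REGISTERED STUB (S3-two, twist transfer at `2`; bookkeeping, OPEN in the tree): the same at the place
over `2` — `E` additive potentially multiplicative at `2` is the twist of a curve `E'` multiplicative at `2`
by `ℚ(√−1)` or `ℚ(√±2)` (ramified exactly at `2`), `f_2(E) ∈ {4, 6}`, `N_E = 2^{f−1} N_{E'}`,
`ord_2 Δ_min(E) = n + 3f` (`n + 12`, `n + 18`; Comalada 1994 = the tree's `QuadraticTwistTateFormTwoProofs`),
and `3f ≤ 6(f − 1)`. -/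
theorem stub_twistTransferTwo : (∀ ε : ℝ, 0 < ε → ∃ C : ℝ, ∀ (W : WeierstrassCurve ℚ) [W.IsElliptic] (v : HeightOneSpectrum ℤ), W.conductorExponent v = 1 → (W.ordMinimalDiscriminant v : ℝ) * Real.log (Rat.HeightOneSpectrum.natGenerator v : ℝ) ≤ (6 + ε) * Real.log (W.conductorNorm ℤ : ℝ) + C) → ∀ ε : ℝ, 0 < ε → ∃ C : ℝ, ∀ (W : WeierstrassCurve ℚ) [W.IsElliptic] (v : HeightOneSpectrum ℤ), Rat.HeightOneSpectrum.natGenerator v = 2 → W.conductorExponent v ≠ 1 → 1 < v.valuation ℚ W.j → (W.ordMinimalDiscriminant v : ℝ) * Real.log (Rat.HeightOneSpectrum.natGenerator v : ℝ) ≤ (6 + ε) * Real.log (W.conductorNorm ℤ : ℝ) + C :=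
  Summit.ABC.ABC.Theorems.SingleTowerSzpiroLine.stub_twistTransferTwo

/-- COMPOSITION (kernel-checked modulo the stubs): every place is multiplicative (S1), or has `v(j_E) ≥ 0`
(potentially good: S2-odd / S2-two), or is additive potentially multiplicative (S3 applied to S1); the
constant is the max of the four constants (`B log 2` at `2`; `5 ≤ 6 + ε` and `log N_E ≥ 0` elsewhere). -/
theorem SingleTowerSzpiro_of
    (h1 : ∀ ε : ℝ, 0 < ε → ∃ C : ℝ, ∀ (W : WeierstrassCurve ℚ) [W.IsElliptic]
      (v : HeightOneSpectrum ℤ), W.conductorExponent v = 1 →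
        (W.ordMinimalDiscriminant v : ℝ) * Real.log (Rat.HeightOneSpectrum.natGenerator v : ℝ) ≤
          (6 + ε) * Real.log (W.conductorNorm ℤ : ℝ) + C)
    (h2 : ∃ C : ℝ, ∀ (W : WeierstrassCurve ℚ) [W.IsElliptic] (v : HeightOneSpectrum ℤ),
      Rat.HeightOneSpectrum.natGenerator v ≠ 2 → v.valuation ℚ W.j ≤ 1 →
        (W.ordMinimalDiscriminant v : ℝ) * Real.log (Rat.HeightOneSpectrum.natGenerator v : ℝ) ≤
          5 * Real.log (W.conductorNorm ℤ : ℝ) + C)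
    (h3 : ∃ B : ℕ, ∀ (W : WeierstrassCurve ℚ) [W.IsElliptic] (v : HeightOneSpectrum ℤ),
      Rat.HeightOneSpectrum.natGenerator v = 2 → v.valuation ℚ W.j ≤ 1 → W.ordMinimalDiscriminant v ≤ B)
    (h4 : ∀ ε : ℝ, 0 < ε → ∃ C : ℝ, ∀ (W : WeierstrassCurve ℚ) [W.IsElliptic]
      (v : HeightOneSpectrum ℤ), Rat.HeightOneSpectrum.natGenerator v ≠ 2 → W.conductorExponent v ≠ 1 →
        1 < v.valuation ℚ W.j →
        (W.ordMinimalDiscriminant v : ℝ) * Real.log (Rat.HeightOneSpectrum.natGenerator v : ℝ) ≤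
          (6 + ε) * Real.log (W.conductorNorm ℤ : ℝ) + C)
    (h5 : ∀ ε : ℝ, 0 < ε → ∃ C : ℝ, ∀ (W : WeierstrassCurve ℚ) [W.IsElliptic]
      (v : HeightOneSpectrum ℤ), Rat.HeightOneSpectrum.natGenerator v = 2 → W.conductorExponent v ≠ 1 →
        1 < v.valuation ℚ W.j →
        (W.ordMinimalDiscriminant v : ℝ) * Real.log (Rat.HeightOneSpectrum.natGenerator v : ℝ) ≤
          (6 + ε) * Real.log (W.conductorNorm ℤ : ℝ) + C) :
    SingleTowerSzpiro := by
  intro ε hε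
  obtain ⟨C₁, hC₁⟩ := h1 ε hε
  obtain ⟨C₂, hC₂⟩ := h2
  obtain ⟨B, hB⟩ := h3
  obtain ⟨C₄', hC₄'⟩ := h4 ε hε
  obtain ⟨C₅, hC₅⟩ := h5 ε hε
  -- one constant for both twist-transfer branches
  obtain ⟨C₄, hC₄⟩ : ∃ C₄ : ℝ, ∀ (W : WeierstrassCurve ℚ) [W.IsElliptic] (v : HeightOneSpectrum ℤ),
      W.conductorExponent v ≠ 1 → 1 < v.valuation ℚ W.j →
        (W.ordMinimalDiscriminant v : ℝ) * Real.log (Rat.HeightOneSpectrum.natGenerator v : ℝ) ≤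
          (6 + ε) * Real.log (W.conductorNorm ℤ : ℝ) + C₄ := by
    refine ⟨max C₄' C₅, fun W _ v hf hj => ?_⟩
    by_cases hp : Rat.HeightOneSpectrum.natGenerator v = 2
    · exact (hC₅ W v hp hf hj).trans (by gcongr; exact le_max_right _ _)
    · exact (hC₄' W v hp hf hj).trans (by gcongr; exact le_max_left _ _)
  refine ⟨max (max C₁ C₄) (max C₂ ((B : ℝ) * Real.log 2)), fun W _ v => ?_⟩
  have hN1 : (1 : ℝ) ≤ (W.conductorNorm ℤ : ℝ) := by
    exact_mod_cast WeierstrassCurve.conductorNorm_pos_holds W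
  have hlogN : 0 ≤ Real.log (W.conductorNorm ℤ : ℝ) := Real.log_nonneg hN1
  have hmax₁ : C₁ ≤ max (max C₁ C₄) (max C₂ ((B : ℝ) * Real.log 2)) :=
    (le_max_left _ _).trans (le_max_left _ _)
  have hmax₄ : C₄ ≤ max (max C₁ C₄) (max C₂ ((B : ℝ) * Real.log 2)) :=
    (le_max_right _ _).trans (le_max_left _ _)
  have hmax₂ : C₂ ≤ max (max C₁ C₄) (max C₂ ((B : ℝ) * Real.log 2)) :=
    (le_max_left _ _).trans (le_max_right _ _)
  have hmaxB : (B : ℝ) * Real.log 2 ≤ max (max C₁ C₄) (max C₂ ((B : ℝ) * Real.log 2)) :=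
    (le_max_right _ _).trans (le_max_right _ _)
  by_cases hf : W.conductorExponent v = 1
  · exact (hC₁ W v hf).trans (by linarith)
  by_cases hj : v.valuation ℚ W.j ≤ 1
  · by_cases hp : Rat.HeightOneSpectrum.natGenerator v = 2
    · have hb : (W.ordMinimalDiscriminant v : ℝ) ≤ B := by exact_mod_cast hB W v hp hj
      have hlog2 : (0 : ℝ) ≤ Real.log 2 := Real.log_nonneg one_le_two
      rw [hp, Nat.cast_ofNat]
      have h6 : 0 ≤ (6 + ε) * Real.log (W.conductorNorm ℤ : ℝ) := by positivity
      nlinarith [hb, hlog2, hmaxB, h6]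
    · have h := hC₂ W v hp hj
      nlinarith [h, hlogN, hmax₂, hε]
  · exact (hC₄ W v hf (not_le.mp hj)).trans (by linarith)

/-- The crux from the registered stubs (closes `SingleTowerSzpiro` BY NAME modulo the open `stub_*`). -/
theorem SingleTowerSzpiro_of_stubs : SingleTowerSzpiro :=
  SingleTowerSzpiro_of stub_multiplicativeTower stub_potentiallyGoodTowerOdd stub_potentiallyGoodOrdTwo
    (stub_twistTransferOdd stub_multiplicativeTower) (stub_twistTransferTwo stub_multiplicativeTower)

/-- Sanity link (PROVED, no stub): the first deliverable is implied by the crux itself only in the weak sense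
that both follow from Szpiro `6+ε`; recorded here is the proved ordering `SzpiroConjecture → SingleTowerSzpiro`
(`Summit.ABC.ABC.Theorems.singleTowerSzpiro_of_szpiroConjecture`), so a refutation of any stub instance at
fixed `ε` refutes Szpiro `6+ε`. -/
theorem singleTowerSzpiro_of_szpiro
    (hS : Literature.NumberTheory.EllipticCurves.SzpiroConjecture) : SingleTowerSzpiro :=
  Summit.ABC.ABC.Theorems.singleTowerSzpiro_of_szpiroConjecture hS

/-! ## Calibration (rev 5/5b/6) — kernel theorems BY NAME; nothing here is a stub or a new proof

All names live in `Summit.ABC.ABC.Theorems.SingleTowerSzpiroLine` (files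
`Theorems/PlacewiseSzpiroSingleTowerSzpiro{IffMultiplicative,FirstDeliverableCalib,FreySmallPrimes,FreyLargePrimes,
MersenneRadical,MersenneRadicalRungs}.lean`, all ACCEPTED `--supports stmt-ABC-22410`). -/

/-- ★ p581193: the crux IS its multiplicative part — `SingleTowerSzpiro ↔ stub_multiplicativeTower`-statement. -/
theorem singleTowerSzpiro_iff_stub_multiplicativeTower :
    SingleTowerSzpiro ↔
      (∀ ε : ℝ, 0 < ε → ∃ C : ℝ, ∀ (W : WeierstrassCurve ℚ) [W.IsElliptic]
        (v : HeightOneSpectrum ℤ), W.conductorExponent v = 1 →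
          (W.ordMinimalDiscriminant v : ℝ) * Real.log (Rat.HeightOneSpectrum.natGenerator v : ℝ) ≤
            (6 + ε) * Real.log (W.conductorNorm ℤ : ℝ) + C) :=
  Summit.ABC.ABC.Theorems.SingleTowerSzpiroLine.singleTowerSzpiro_iff_multiplicativeTower

/-- ★ p584725 (why the FD stub is retired): the critic's first deliverable, read over all `E/ℚ`, is EQUIVALENT to
a global Szpiro exponent below `1/3` — `∃ α < 1/3, SzpiroEpsShape α` (record `α = 1`, Murty–Pasten; `1/3` on the
Frey locus only, Stewart–Yu). -/
theorem firstDeliverable_iff_exists_szpiroEpsShape_lt_third :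
    (∃ δ : ℝ, 0 < δ ∧ ∃ C : ℝ, ∀ (W : WeierstrassCurve ℚ) [W.IsElliptic] (v : HeightOneSpectrum ℤ),
      (W.ordMinimalDiscriminant v : ℝ) * Real.log (Rat.HeightOneSpectrum.natGenerator v : ℝ) ≤
        C * (W.conductorNorm ℤ : ℝ) ^ ((1 : ℝ) / 3 - δ)) ↔
    ∃ α : ℝ, α < 1 / 3 ∧ Summit.ABC.Harvest.SzpiroEpsShape α :=
  Summit.ABC.ABC.Theorems.SingleTowerSzpiroLine.firstDeliverable_iff_exists_szpiroEpsShape_lt_third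

/-- ★ p584725: the crux implies the (retired) first-deliverable shape — recorded so that the retirement loses no
ordering: X1 ⟹ FD ⟹ `∃ θ < 1/3, Literature.Barriers.ABC.EpsShapeBound θ` (beyond `BakerMethodBounds`). -/
theorem firstDeliverable_of_crux (hX : SingleTowerSzpiro) :
    ∃ δ : ℝ, 0 < δ ∧ ∃ C : ℝ, ∀ (W : WeierstrassCurve ℚ) [W.IsElliptic] (v : HeightOneSpectrum ℤ),
      (W.ordMinimalDiscriminant v : ℝ) * Real.log (Rat.HeightOneSpectrum.natGenerator v : ℝ) ≤
        C * (W.conductorNorm ℤ : ℝ) ^ ((1 : ℝ) / 3 - δ) :=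
  Summit.ABC.ABC.Theorems.SingleTowerSzpiroLine.firstDeliverable_of_singleTowerSzpiro hX

/-- ★ p584725: … and hence a Stewart–Yu-beating ε-shape bound on abc triples. -/
theorem exists_epsShapeBound_lt_third_of_crux (hX : SingleTowerSzpiro) :
    ∃ θ : ℝ, θ < 1 / 3 ∧ Literature.Barriers.ABC.EpsShapeBound θ :=
  Summit.ABC.ABC.Theorems.SingleTowerSzpiroLine.exists_epsShapeBound_lt_third_of_firstDeliverable
    (firstDeliverable_of_crux hX)

/-- ★ p587522 (rev 5b, MERSENNE YARDSTICK): the crux stub at the single place `2` on the Mersenne Frey family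
`y² = x(x+1)(x+2ⁿ)` already gives an EXPONENTIAL lower bound for the radical of Mersenne numbers,
`rad(2ⁿ−1) ≥ c(ε) · 2^{n/(3+ε)}` (`n ≥ 5`) — open for every positive exponent (unconditional record
`rad ≫ n³/(log n)⁹`, Stewart–Yu = `BakerMethodBounds`). Modulo the stub. -/
theorem radical_mersenne_ge_of_crux {ε : ℝ} (hε : 0 < ε) :
    ∃ c : ℝ, 0 < c ∧ ∀ n : ℕ, 5 ≤ n →
      c * (2 : ℝ) ^ ((1 / (3 + ε)) * n) ≤
        ((UniqueFactorizationMonoid.radical (mersenne n) : ℕ) : ℝ) :=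
  Summit.ABC.ABC.Theorems.SingleTowerSzpiroLine.radical_mersenne_ge_of_singleTower stub_multiplicativeTower hε

/-- ★ p587903 + ★ p575330 (rev 5b): through the line's booked rung A1′
(`SingleTowerSzpiro ⟹ Summit.ABC.Harvest.SubexponentialSzpiro`, `subexponentialSzpiro_of_singleTowerSzpiro`)
the crux gives `rad(2ⁿ−1) ≥ c(A) · n^A` for every `A > 0`. Modulo the stub. A1′ is NOT abc. -/
theorem radical_mersenne_ge_pow_of_crux {A : ℝ} (hA : 0 < A) :
    ∃ c : ℝ, 0 < c ∧ ∀ n : ℕ, 5 ≤ n →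
      c * (n : ℝ) ^ A ≤ ((UniqueFactorizationMonoid.radical (mersenne n) : ℕ) : ℝ) :=
  Summit.ABC.ABC.Theorems.SingleTowerSzpiroLine.radical_mersenne_ge_pow_of_subexponentialSzpiro
    (Summit.ABC.ABC.Theorems.subexponentialSzpiro_of_singleTowerSzpiro SingleTowerSzpiro_of_stubs) hA

end Summit.ABC.ABC.Cruxes.SingleTowerSzpiro.Birth

end
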